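import Mathlib
import Summits.Ventures.HodgeRepro2.T5CompletionFundamentalIdentity

/-!
# THE DEGREE OF A COMPLETION AT THE UNIQUE PLACE ABOVE `v`: `[L_w : K_v] = [L : K]` (T5CompletionDegreeOfUnique)

Mathlib's fundamental identity `∑_{P ∣ v} e(P∣v) · f(P∣v) = [L : K]` (`Ideal.sum_ramification_inertia`) together with
`[L_w : K_v] = e(w∣v) · f(w∣v)` (T5CompletionFundamentalIdentity) gives, when `w` is the ONLY place of `L` above `v`,
`[L_w : K_v] = [L : K]`. For a quadratic `L/K` this is the hypothesis `h2 = «[L_w : K_v] = 2»` of the local-field chain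
(rows 165–177) and of t6-p8's per-place statements at EVERY non-split place, read off the global structure alone
(`finrank_eq_two_of_unique`).

No axiom beyond the standard trio; nothing of the scored record changes.
§8(d): uses an L-value-free non-vanishing device: NO.
-/

namespace Summit.Ventures.HodgeRepro2.T5CompletionDegreeOfUnique

open IsDedekindDomain HeightOneSpectrum NumberField

variable {K : Type*} [Field K] [NumberField K] (v : HeightOneSpectrum (NumberField.RingOfIntegers K))
  {L : Type*} [Field L] [NumberField L] [Algebra K L] (w : HeightOneSpectrum (NumberField.RingOfIntegers L))
  [w.asIdeal.LiesOver v.asIdeal]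

omit [NumberField K] [NumberField L] in
/-- A prime of `𝓞_L` lying over `v` is non-zero. -/
theorem ne_bot_of_liesOver {P : Ideal (NumberField.RingOfIntegers L)} [P.LiesOver v.asIdeal] : P ≠ ⊥ := by
  rintro rfl
  have h := Ideal.LiesOver.over (P := (⊥ : Ideal (NumberField.RingOfIntegers L))) (p := v.asIdeal)
  rw [Ideal.under, Ideal.comap_bot_of_injective _ (FaithfulSMul.algebraMap_injective _ _)] at h
  exact v.ne_bot h

/-- If `w` is the only place of `L` above `v`, the primes of `𝓞_L` over `v` form the singleton `{w.asIdeal}`. -/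
theorem primesOverFinset_eq_singleton
    (huniq : ∀ w' : HeightOneSpectrum (NumberField.RingOfIntegers L), w'.asIdeal.LiesOver v.asIdeal → w' = w) :
    IsDedekindDomain.primesOverFinset v.asIdeal (NumberField.RingOfIntegers L) = {w.asIdeal} := by
  ext P
  rw [IsDedekindDomain.mem_primesOverFinset_iff v.ne_bot, Finset.mem_singleton]
  constructor
  · rintro ⟨hP, hlo⟩
    haveI := hP
    haveI := hlo
    have hne : P ≠ ⊥ := ne_bot_of_liesOver v
    have := huniq ⟨P, hP, hne⟩ hlo
    rw [← this]
  · rintro rfl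
    exact ⟨w.isPrime, inferInstance⟩

/-- THE DEGREE AT THE UNIQUE PLACE ABOVE `v`: `[L_w : K_v] = [L : K]` when `w` is the only place of `L` above `v`. -/
theorem finrank_eq_of_unique
    (huniq : ∀ w' : HeightOneSpectrum (NumberField.RingOfIntegers L), w'.asIdeal.LiesOver v.asIdeal → w' = w) :
    Module.finrank (v.adicCompletion K) (w.adicCompletion L) = Module.finrank K L := by
  haveI : v.asIdeal.IsMaximal := v.isMaximal
  rw [Summit.Ventures.HodgeRepro2.T5CompletionFundamentalIdentity.finrank_eq_ramificationIdx'_mul_inertiaDeg',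
    ← Ideal.sum_ramification_inertia (NumberField.RingOfIntegers L) K L v.ne_bot,
    primesOverFinset_eq_singleton v w huniq, Finset.sum_singleton]

/-- FOR A QUADRATIC `L/K`: `[L_w : K_v] = 2` at every place `w` that is the only one above `v` (inert or ramified) — the
chain's hypothesis `h2` from the global structure. -/
theorem finrank_eq_two_of_unique (hKL : Module.finrank K L = 2)
    (huniq : ∀ w' : HeightOneSpectrum (NumberField.RingOfIntegers L), w'.asIdeal.LiesOver v.asIdeal → w' = w) :
    Module.finrank (v.adicCompletion K) (w.adicCompletion L) = 2 := by
  rw [finrank_eq_of_unique v w huniq, hKL]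

end Summit.Ventures.HodgeRepro2.T5CompletionDegreeOfUnique
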